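import Summits.Ventures.PercRepro.S1CFCapsFour

/-!
# PercRepro — `Q₄²`: THE `4`-SETS OF RANK `≤ 2` OF A LOOPLESS COLOOP-FREE MATROID OF NULLITY `4` ON `12` POINTS (p1, gen 37)

The cap `Q₄²` of p7's ν = 4 program (the extremal value `C(4, 3)·8 + 1 = 33`). A `4`-set `X` of rank `≤ 2` either contains
a dependent pair `P = {p, p'}` — then `X = P ∪ Y` with `{p} ∪ Y` dependent: `Y` meets `cl {p}` (so `X` contains a rank-`1`
triple: `≤ 9 · Q₃¹`), or `Y` is a dependent pair (`≤ D₂²`), or `{p} ∪ Y` is a triangle with `Y` outside `cl {p}` (a relative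
circuit of size `2` of the set `{p} ∪ (E ∖ cl {p})`, of nullity `≤ 3`: `≤ 6` per pair) — or it has no dependent pair, and
then it is a `4`-subset of ONE line of `≤ 5` points (two such `4`-sets span a proper subset of nullity `≥ 4` unless they
share a spanning pair): `≤ 5`. **`ncard_four_eRk_le_two_le_split`**: `Q₄² ≤ 9 · Q₃¹ + D₂² + 6 · D₂ + 5`;
**`ncard_three_eRk_le_one_le_one_of_le_five`**: `D₂ ≤ 5 ⇒ Q₃¹ ≤ 1`; **`ncard_four_eRk_le_two_le_of_five_le`**:
`D₂ ≥ 5 ⇒ Q₄² ≤ 33` (the `4`-sets meeting the class of `4` in `≥ 3` points); **`ncard_four_eRk_le_two_le_fortyone`**: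
`Q₄² ≤ 41` unconditionally (`≤ 41` at `D₂ ≤ 3`, `≤ 54` at `D₂ = 4` improved to `≤ 30` by LEMMA K, `≤ 33` at `D₂ ≥ 5`).
Nothing about any cell is claimed. Axioms: standard.
-/

open scoped Matroid

namespace PercRepro

namespace S1CF

open Set

variable {α : Type}

/-- **A union bound**: the sets lying in some `T P` (`P` ranging over a finite family `𝒞`, each `T P` of size `≤ m`)
number at most `m · #𝒞`. -/
theorem ncard_exists_mem_le {𝒞 : Set (Set α)} (h𝒞 : 𝒞.Finite) (T : Set α → Set (Set α)) {m : ℕ}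
    (hT : ∀ P ∈ 𝒞, (T P).Finite ∧ (T P).ncard ≤ m) :
    {X : Set α | ∃ P ∈ 𝒞, X ∈ T P}.ncard ≤ m * 𝒞.ncard := by
  classical
  set Cf : Finset (Set α) := h𝒞.toFinset with hCf
  set Tf : Set α → Finset (Set α) := fun P =>
    if h : P ∈ 𝒞 then (hT P h).1.toFinset else ∅ with hTf
  have hsub : {X : Set α | ∃ P ∈ 𝒞, X ∈ T P} ⊆ ((Cf.biUnion Tf : Finset (Set α)) : Set (Set α)) := by
    intro X hX
    obtain ⟨P, hP, hXP⟩ := hX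
    rw [Finset.coe_biUnion]
    refine Set.mem_iUnion₂.2 ⟨P, ?_, ?_⟩
    · rw [Finset.mem_coe, hCf, Set.Finite.mem_toFinset]
      exact hP
    · rw [hTf]
      simp only [hP, dite_true, Set.Finite.coe_toFinset]
      exact hXP
  have hbound : ∀ P ∈ Cf, (Tf P).card ≤ m := by
    intro P hP
    rw [hCf, Set.Finite.mem_toFinset] at hP
    rw [hTf]
    simp only [hP, dite_true]
    rw [← Set.ncard_coe_finset, Set.Finite.coe_toFinset]
    exact (hT P hP).2
  calc {X : Set α | ∃ P ∈ 𝒞, X ∈ T P}.ncard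
      ≤ ((Cf.biUnion Tf : Finset (Set α)) : Set (Set α)).ncard :=
        Set.ncard_le_ncard hsub (Finset.finite_toSet _)
    _ = (Cf.biUnion Tf).card := Set.ncard_coe_finset _
    _ ≤ Cf.card * m := Finset.card_biUnion_le_card_mul _ _ _ hbound
    _ = m * 𝒞.ncard := by rw [mul_comm, hCf, ← Set.ncard_coe_finset, Set.Finite.coe_toFinset]

/-- A set of two points with no dependent pair has rank `≥ 2`; more generally a set with two distinct non-parallel
points has rank `≥ 2`. -/
theorem two_le_eRk_of_indep_pair (M : Matroid α) {X : Set α} {u v : α} (hu : u ∈ X) (hv : v ∈ X)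
    (huv : u ≠ v) (hind : M.Indep {u, v}) : 2 ≤ M.eRk X := by
  have h1 : M.eRk {u, v} = 2 := by
    rw [hind.eRk_eq_encard, Set.encard_pair huv]
  rw [← h1]
  exact M.eRk_mono (by intro w hw; rcases hw with rfl | rfl; exacts [hu, hv])

/-- **The `4`-sets of rank `≤ 2` with no dependent pair lie in one line of `≤ 5` points: at most `5`.** -/
theorem ncard_four_eRk_le_two_no_pair_le_five (M : Matroid α) [M.Finite] (hL : ∀ e ∈ M.E, ¬ M.IsLoop e)
    (hK : ∀ e, ¬ M.IsColoop e) (hd : M.E.encard = M.eRank + ((4 : ℕ) : ℕ∞)) (hn : M.E.ncard = 12) :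
    {X : Set α | X ⊆ M.E ∧ X.ncard = 4 ∧ M.eRk X ≤ 2 ∧ ∀ P ⊆ X, P.ncard = 2 → ¬ M.Dep P}.ncard ≤ 5 := by
  classical
  have hEfin := M.ground_finite
  set 𝒬 := {X : Set α | X ⊆ M.E ∧ X.ncard = 4 ∧ M.eRk X ≤ 2 ∧ ∀ P ⊆ X, P.ncard = 2 → ¬ M.Dep P} with h𝒬
  rcases 𝒬.eq_empty_or_nonempty with hemp | ⟨X₀, hX₀⟩
  · rw [hemp]; simp
  obtain ⟨hX₀E, hX₀4, hX₀r, hX₀no⟩ := hX₀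
  have hX₀fin : X₀.Finite := hEfin.subset hX₀E
  -- two distinct points of `X₀` form an independent pair spanning `X₀`
  obtain ⟨u, hu⟩ : X₀.Nonempty := by rw [← Set.ncard_pos hX₀fin, hX₀4]; norm_num
  obtain ⟨v, hv, hvu⟩ := Set.exists_ne_of_one_lt_ncard (by rw [hX₀4]; norm_num) u
  have huv : ({u, v} : Set α) ⊆ X₀ := by intro w hw; rcases hw with rfl | rfl; exacts [hu, hv]
  have hind : M.Indep {u, v} := by
    rw [← Matroid.not_dep_iff (huv.trans hX₀E)]
    exact hX₀no _ huv (Set.ncard_pair (Ne.symm hvu))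
  set L := M.closure {u, v} with hLdef
  have hLE : L ⊆ M.E := M.closure_subset_ground _
  have hLfin : L.Finite := hEfin.subset hLE
  have hLr : M.eRk L ≤ 2 := by
    rw [hLdef, M.eRk_closure_eq, hind.eRk_eq_encard, Set.encard_pair (Ne.symm hvu)]
  have hL5 : L.ncard ≤ 5 := by
    have := ncard_le_eRk_toNat_add_three M hK hd hn hLE
      (by have := eRk_toNat_le_of_eRk_le M hLE (m := 2) (by exact_mod_cast hLr); omega)
    have h2 := eRk_toNat_le_of_eRk_le M hLE (m := 2) (by exact_mod_cast hLr)
    omega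
  -- `X₀ ⊆ L`, and every member of `𝒬` lies in `L`
  have hX₀L : X₀ ⊆ L := by
    intro w hw
    by_cases hwuv : w ∈ ({u, v} : Set α)
    · exact M.subset_closure _ (huv.trans hX₀E) hwuv
    · have hdep : M.Dep (insert w {u, v}) := by
        have hsub : insert w {u, v} ⊆ X₀ := Set.insert_subset hw huv
        have hfin : (insert w {u, v} : Set α).Finite := hX₀fin.subset hsub
        rw [← Matroid.eRk_lt_encard_iff_dep_of_finite hfin (hsub.trans hX₀E),
          Set.encard_insert_of_notMem hwuv, Set.encard_pair (Ne.symm hvu)]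
        calc M.eRk (insert w {u, v}) ≤ M.eRk X₀ := M.eRk_mono hsub
          _ ≤ 2 := hX₀r
          _ < 2 + 1 := by norm_num
      rw [hind.insert_dep_iff] at hdep
      exact hdep.1
  have hsub : 𝒬 ⊆ {X : Set α | X ⊆ L ∧ X.ncard = 4} := by
    intro X hX
    obtain ⟨hXE, hX4, hXr, hXno⟩ := hX
    refine ⟨?_, hX4⟩
    have hXfin : X.Finite := hEfin.subset hXE
    -- the union `X₀ ∪ X` is a proper subset; its nullity forces `X` into `L`
    have hU : X₀ ∪ X ⊆ M.E := union_subset hX₀E hXE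
    have hUr : M.eRk (X₀ ∪ X) + M.eRk (X₀ ∩ X) ≤ 4 := by
      have := M.eRk_inter_add_eRk_union_le X₀ X
      calc M.eRk (X₀ ∪ X) + M.eRk (X₀ ∩ X) = M.eRk (X₀ ∩ X) + M.eRk (X₀ ∪ X) := add_comm _ _
        _ ≤ M.eRk X₀ + M.eRk X := this
        _ ≤ 2 + 2 := add_le_add hX₀r hXr
        _ = 4 := by norm_num
    have hUcard := Set.ncard_union_add_ncard_inter X₀ X hX₀fin hXfin
    -- case on the size of the intersection
    by_cases hI3 : 3 ≤ (X₀ ∩ X).ncard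
    · -- three common points span `L`
      obtain ⟨a, ha⟩ : (X₀ ∩ X).Nonempty := by
        rw [← Set.ncard_pos (hX₀fin.subset inter_subset_left)]; omega
      obtain ⟨b, hb, hba⟩ := Set.exists_ne_of_one_lt_ncard (by omega : 1 < (X₀ ∩ X).ncard) a
      have hab : ({a, b} : Set α) ⊆ X₀ ∩ X := by intro w hw; rcases hw with rfl | rfl; exacts [ha, hb]
      have habind : M.Indep {a, b} := by
        rw [← Matroid.not_dep_iff ((hab.trans inter_subset_left).trans hX₀E)]
        exact hX₀no _ (hab.trans inter_subset_left) (Set.ncard_pair (Ne.symm hba))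
      -- `cl {a, b} = L` since `{a, b} ⊆ X₀ ⊆ L` spans rank 2
      have hcl : M.closure {a, b} = L := by
        apply le_antisymm
        · exact M.closure_subset_closure_of_subset_closure ((hab.trans inter_subset_left).trans hX₀L)
        · -- `L` has rank 2 and `{a, b}` is an independent pair inside it
          have h1 : M.closure {a, b} ⊆ L := M.closure_subset_closure_of_subset_closure
            ((hab.trans inter_subset_left).trans hX₀L)
          by_contra hne
          obtain ⟨z, hzL, hzcl⟩ := Set.not_subset.1 hne
          have hzE : z ∈ M.E := hLE hzL
          have hind' : M.Indep (insert z {a, b}) := by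
            rw [habind.insert_indep_iff_of_notMem (fun h => hzcl (M.subset_closure _
              ((hab.trans inter_subset_left).trans hX₀E) h))]
            exact ⟨hzE, hzcl⟩
          have h3 : M.eRk (insert z {a, b}) = 3 := by
            rw [hind'.eRk_eq_encard, Set.encard_insert_of_notMem (fun h => hzcl (M.subset_closure _
              ((hab.trans inter_subset_left).trans hX₀E) h)), Set.encard_pair (Ne.symm hba)]
            norm_num
          have hle : M.eRk (insert z {a, b}) ≤ M.eRk L :=
            M.eRk_mono (Set.insert_subset hzL ((hab.trans inter_subset_left).trans hX₀L))
          rw [h3] at hle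
          have : (3 : ℕ∞) ≤ 2 := hle.trans hLr
          norm_num at this
      -- `X ⊆ cl {a, b}`
      rw [← hcl]
      intro w hw
      by_cases hwab : w ∈ ({a, b} : Set α)
      · exact M.subset_closure _ ((hab.trans inter_subset_right).trans hXE) hwab
      · have hdep : M.Dep (insert w {a, b}) := by
          have hsub' : insert w {a, b} ⊆ X := Set.insert_subset hw (hab.trans inter_subset_right)
          have hfin : (insert w {a, b} : Set α).Finite := hXfin.subset hsub'
          rw [← Matroid.eRk_lt_encard_iff_dep_of_finite hfin (hsub'.trans hXE),
            Set.encard_insert_of_notMem hwab, Set.encard_pair (Ne.symm hba)]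
          calc M.eRk (insert w {a, b}) ≤ M.eRk X := M.eRk_mono hsub'
            _ ≤ 2 := hXr
            _ < 2 + 1 := by norm_num
        rw [habind.insert_dep_iff] at hdep
        exact hdep.1
    · -- at most two common points: `X₀ ∪ X` has `≥ 6` points and rank `≤ 4 − rk (X₀ ∩ X)`
      exfalso
      push Not at hI3
      have hUr' : (M.eRk (X₀ ∪ X)).toNat + (M.eRk (X₀ ∩ X)).toNat ≤ 4 := by
        have h := hUr
        rw [← S1.coe_toNat_eRk M hU, ← S1.coe_toNat_eRk M (inter_subset_left.trans hX₀E)] at h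
        exact_mod_cast h
      have hnull := ncard_le_eRk_toNat_add_three M hK hd hn hU (by omega)
      -- the intersection: empty, a point, or an independent pair
      rcases Nat.lt_or_ge (X₀ ∩ X).ncard 2 with hlt | hge
      · -- `|X₀ ∩ X| ≤ 1`: `|X₀ ∪ X| ≥ 7`, rank `≤ 3` (a common point has rank `1`)
        rcases Nat.lt_or_ge (X₀ ∩ X).ncard 1 with h0 | h1
        · omega
        · have hI1 : (X₀ ∩ X).ncard = 1 := by omega
          obtain ⟨a, ha⟩ := Set.ncard_eq_one.1 hI1
          have haI : a ∈ X₀ ∩ X := by rw [ha]; exact Set.mem_singleton a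
          have haE : a ∈ M.E := hX₀E haI.1
          have hr1 : (M.eRk (X₀ ∩ X)).toNat = 1 := by
            rw [ha, ((Matroid.not_isLoop_iff haE).1 (hL a haE)).eRk_eq]; rfl
          omega
      · -- `|X₀ ∩ X| = 2`: an independent pair, rank `2`, so `rk (X₀ ∪ X) ≤ 2` on `6` points
        have hI2 : (X₀ ∩ X).ncard = 2 := by omega
        obtain ⟨a, b, hab', hI⟩ := Set.ncard_eq_two.1 hI2
        have habind : M.Indep {a, b} := by
          have hsub' : ({a, b} : Set α) ⊆ X₀ := by rw [← hI]; exact inter_subset_left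
          rw [← Matroid.not_dep_iff (hsub'.trans hX₀E)]
          exact hX₀no _ hsub' (Set.ncard_pair hab')
        have h2 : (M.eRk (X₀ ∩ X)).toNat = 2 := by
          rw [hI, habind.eRk_eq_encard, Set.encard_pair hab']; rfl
        omega
  calc 𝒬.ncard ≤ {X : Set α | X ⊆ L ∧ X.ncard = 4}.ncard :=
        Set.ncard_le_ncard hsub (hLfin.finite_subsets.subset (fun X hX => hX.1))
    _ = L.ncard.choose 4 := ncard_subsets_eq_choose hLfin 4
    _ ≤ (5 : ℕ).choose 4 := Nat.choose_le_choose 4 hL5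
    _ = 5 := by decide

end S1CF

end PercRepro
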